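import Literature.Algebra.Module.ThreeTermComplexGrauertReduced
import Literature.Algebra.Module.ThreeTermComplexExchangeBasicOpen
import HarnessLib

/-!
# The jump locus of the fibre Betti number: `b` is locally constant exactly on the common exchange locus
# `freeLocus (coker d^{i−1}) ∩ freeLocus (coker dⁱ)` — always «⊇», and «=» over a reduced base
# (EGA III 7.8.4; Hartshorne III 12.9 + 12.11; Mumford §5 Cor. 2; Görtz–Wedhorn II 23.140)

Topic `Algebra/Module`; namespace `Literature.Algebra.Module`; theorems only (no definition, named fact, instance, notation,
`sorry`; Mathlib + ★ `Algebra/Module/ThreeTermComplexGrauertReduced` + ★ `Algebra/Module/ThreeTermComplexExchangeBasicOpen`). The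
synthesis of rows 182 ∕ 183 ∕ 185 (tower dictionary, exchange over `D(s)`, Grauert on a reduced base) into the POINTWISE-LOCAL
statement behind Hartshorne III 12.9 ∕ 12.11 and EGA III 7.8.4: for a window `K⁰ —f→ K¹ —g→ K²` (`g ∘ f = 0`) over a commutative
ring `A` with `K¹` finite, `K²` finite projective and `coker f` finitely presented, and its fibre Betti number `b(𝔭) = dim_{κ(𝔭)}
((ker (g ⊗ κ(𝔭))).map (range (f ⊗ κ(𝔭))).mkQ)` (rows 173–187):

* §1 (ANY ring) **`exists_nhd_betti_eq_of_mem_freeLocus`** — if `𝔭` lies in BOTH exchange loci `freeLocus (coker g)` (degree `i`)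
  and `freeLocus (coker f)` (degree `i − 1`), then `b` is CONSTANT on an open neighbourhood of `𝔭` (row 183
  `exists_away_projective_betti_of_mem_freeLocus`: on some `D(s) ∋ 𝔭`, `H(K ⊗ A_s)` is finite projective of rank `b(𝔔 ∩ A)`;
  the rank of a finite projective is locally constant, Mathlib `Module.isLocallyConstant_rankAtStalk`; `Spec A_s → D(s)` is an open
  embedding, Mathlib `PrimeSpectrum.localization_away_isOpenEmbedding`); `isLocallyConstant_betti_restrict_inter_freeLocus` — `b`
  restricted to the open set `freeLocus (coker f) ∩ freeLocus (coker g)` is locally constant.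
* §2 (REDUCED ring) **`mem_freeLocus_of_betti_eq_nhd`** — conversely, if `b` is constant on an open neighbourhood of `𝔭` then `𝔭`
  lies in both exchange loci (shrink to `D(s)`; the Betti function of the base-changed window `K ⊗ A_s` on `Spec A_s` is the
  pull-back of `b`, row 182 `finrank_betti_baseChange_baseChange_eq` + `finrank_betti_baseChange_residueField_eq_of_comap_eq`, hence
  locally constant; `A_s` is reduced (Mathlib instance); row 185 `exists_bettiBaseChangeEquiv_of_isLocallyConstant_betti_of_
  finitePresentation` over `A_s` makes `coker(f ⊗ A_s)`, `coker(g ⊗ A_s)` projective, i.e. `A_s ⊗ coker f`, `A_s ⊗ coker g`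
  projective (★ `tensorQuotRangeEquiv`), i.e. `D(s) ⊆` both free loci, row 183 `basicOpen_subset_freeLocus_iff_projective_tensor`);
  **`setOf_exists_nhd_betti_eq_eq_inter_freeLocus`** — THE SET WHERE `b` IS LOCALLY CONSTANT EQUALS `freeLocus (coker f) ∩ freeLocus
  (coker g)`: the JUMP LOCUS of `b` is the complement of the common exchange locus (EGA III 7.8.4 (a) ⟺ (d) pointwise; Hartshorne
  III 12.9 «⇐» with 12.11; Mumford §5 Cor. 2 (i) ⟺ (ii) read locally), and on it `Hⁱ` is locally free of rank `b` commuting with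
  every base change over the `A_s` (rows 183 ∕ 184).

Against the kin, BY DECL: rows 183 (`exists_away_projective_betti_of_mem_freeLocus`, `rankAtStalk_betti_away`,
`basicOpen_subset_freeLocus_iff_projective_tensor`, `exists_basicOpen_subset_freeLocus`), 182 (the pull-back of the Betti function),
185 (reduced Grauert, assembled form) — engines BY NAME; row 177 ∕ 175 §2 (GLOBAL constancy hypotheses on all of `Spec A`,
connected ∕ domain) and row 181 ∕ 184 (generic point) are the global ∕ generic forms of which this is the pointwise-local one; row
179 (exchange locus open) and row 173 (semicontinuity) are not used. Mathlib used (pin): `PrimeSpectrum.localization_away_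
isOpenEmbedding` ∕ `localization_away_comap_range` ∕ `isTopologicalBasis_basic_opens`, `Module.isLocallyConstant_rankAtStalk`, the
instances `IsReduced (Localization _)` and `Module.FinitePresentation A (A ⊗[R] M)`, `Module.FinitePresentation.of_equiv`.
What is NOT here: the scheme-side formulation («`Rⁱf_*𝓕` is locally free near `y` and commutes with base change», cohomology and
base change for `f : X → S` — not typed in this module-level lane); the closed JUMP SET `Spec A ∖ (freeLocus (coker f) ∩ freeLocus
(coker g))` as a finite union of Fitting ∕ Betti strata (the strata are constructible by row 186
`isConstructible_setOf_finrank_betti_baseChange_eq` ∕ `isConstructible_setOf_finrank_fiber_eq`, `b` is upper semicontinuous by row 173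
`upperSemicontinuous_finrank_betti_baseChange` — not combined here); §2 over NON-REDUCED bases, where it FAILS (over `A = k[ε]` the
window `0 → A —ε→ A` has `b ≡ 1` on the one-point spectrum while `coker ε = k` is not free); merely finite `coker f` (the f.p.
binder is removed by the 00NX-type row `LocallyFreeOfLocallyConstantFibreRank` when it lands). Library only (cell `pub-hodge-ring2`,
count-neutral); proves nothing about any crux, route or conjecture.

## References

* A. Grothendieck, EGA III₂ (1963), 7.8.4 — not held at this pin; cited in prose as by the kin rows. [EGAIII2]
* R. Hartshorne, *Algebraic Geometry*, GTM 52 (1977), III Cor. 12.9, Thm. 12.11 (pp. 288–290; held PDF p0350–p0351). [Hartshorne1977]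
* D. Mumford, *Abelian Varieties* (1970), §5 Cor. 2 (p. 50) — not held at this pin; statement as cited by the kin rows.
  [MumfordAV1970]
* U. Görtz, T. Wedhorn, *Algebraic Geometry II* (2023), Thm. 23.140 (pp. 482–483; held PDF p0482–p0483). [GortzWedhorn2023]
-/

universe u
open TensorProduct Module
open Literature.RingTheory.Flat (tensorQuotRangeEquiv)

namespace Literature.Algebra.Module

section JumpLocus

variable {A : Type u} [CommRing A]
  {K0 K1 K2 : Type u} [AddCommGroup K0] [Module A K0] [AddCommGroup K1] [Module A K1]
  [AddCommGroup K2] [Module A K2] [Module.Finite A K1] [Module.Finite A K2] [Module.Projective A K2]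
  {f : K0 →ₗ[A] K1} {g : K1 →ₗ[A] K2} [Module.FinitePresentation A (K1 ⧸ LinearMap.range f)] (hfg : g ∘ₗ f = 0)
include hfg

/-! ### §1 Any ring: `b` is locally constant on the common exchange locus -/

/-- **On the common exchange locus the Betti number is locally constant** (Hartshorne III 12.11 (b) ⇒ «`Rⁱf_*` locally free of
rank `hⁱ(y)` near `y`», hence `hⁱ` constant near `y`; EGA III 7.8.4 (a) ⇒ (d)), ANY commutative ring: if `𝔭 ∈ freeLocus (coker g)`
and `𝔭 ∈ freeLocus (coker f)` (with `K¹` finite, `K²` finite projective, `coker f` finitely presented) then `b` is constant on an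
open neighbourhood of `𝔭` — on the `D(s)` of row 183 `exists_away_projective_betti_of_mem_freeLocus`, `H(K ⊗ A_s)` is finite
projective of rank `b(𝔔 ∩ A)` at `𝔔`, that rank is locally constant on `Spec A_s`, and `Spec A_s ≅ D(s)` is an open embedding.
[cite: Hartshorne1977, III Thm. 12.11 (b) (p. 290; held PDF p0351)] [cite: GortzWedhorn2023, Thm. 23.140 (2) (p. 482)] -/
theorem exists_nhd_betti_eq_of_mem_freeLocus (p : PrimeSpectrum A) (hp : p ∈ Module.freeLocus A (K2 ⧸ LinearMap.range g))
    (hp' : p ∈ Module.freeLocus A (K1 ⧸ LinearMap.range f)) :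
    ∃ U : Set (PrimeSpectrum A), IsOpen U ∧ p ∈ U ∧ ∀ q ∈ U,
      finrank q.asIdeal.ResidueField ((LinearMap.ker (g.baseChange q.asIdeal.ResidueField)).map
          (LinearMap.range (f.baseChange q.asIdeal.ResidueField)).mkQ) =
        finrank p.asIdeal.ResidueField ((LinearMap.ker (g.baseChange p.asIdeal.ResidueField)).map
          (LinearMap.range (f.baseChange p.asIdeal.ResidueField)).mkQ) := by
  obtain ⟨s, hsp, -, -, hfin, hproj, hrank⟩ := exists_away_projective_betti_of_mem_freeLocus hfg p hp hp'
  haveI := hfin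
  haveI := hproj
  -- the point of `Spec A_s` over `𝔭 ∈ D(s)`
  have hpD : p ∈ (PrimeSpectrum.basicOpen s : Set (PrimeSpectrum A)) := by
    rw [SetLike.mem_coe, PrimeSpectrum.mem_basicOpen]; exact hsp
  obtain ⟨P, hP⟩ : p ∈ Set.range (PrimeSpectrum.comap (algebraMap A (Localization.Away s))) := by
    rw [PrimeSpectrum.localization_away_comap_range (Localization.Away s) s]; exact hpD
  -- the rank of the finite projective `H(K ⊗ A_s)` is locally constant on `Spec A_s`
  have hlc : IsLocallyConstant (Module.rankAtStalk (R := Localization.Away s)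
      ↥((LinearMap.ker (g.baseChange (Localization.Away s))).map
        (LinearMap.range (f.baseChange (Localization.Away s))).mkQ)) := by
    haveI := Module.finitePresentation_of_projective (Localization.Away s)
      ↥((LinearMap.ker (g.baseChange (Localization.Away s))).map (LinearMap.range (f.baseChange (Localization.Away s))).mkQ)
    exact Module.isLocallyConstant_rankAtStalk
  -- its level set through `P`, carried to `Spec A` by the open embedding `Spec A_s → D(s) ⊆ Spec A`
  let W : Set (PrimeSpectrum (Localization.Away s)) := {Q | Module.rankAtStalk
    ↥((LinearMap.ker (g.baseChange (Localization.Away s))).map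
      (LinearMap.range (f.baseChange (Localization.Away s))).mkQ) Q = Module.rankAtStalk
    ↥((LinearMap.ker (g.baseChange (Localization.Away s))).map
      (LinearMap.range (f.baseChange (Localization.Away s))).mkQ) P}
  refine ⟨PrimeSpectrum.comap (algebraMap A (Localization.Away s)) '' W,
    (PrimeSpectrum.localization_away_isOpenEmbedding (Localization.Away s) s).isOpenMap _ (hlc.isOpen_fiber _),
    ⟨P, rfl, hP⟩, ?_⟩
  rintro q ⟨Q, hQ, rfl⟩
  rw [← hP, ← hrank Q, ← hrank P]
  exact hQ

/-- Hence `b` restricted to the (open) common exchange locus `freeLocus (coker f) ∩ freeLocus (coker g)` is LOCALLY CONSTANT.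
[cite: Hartshorne1977, III Thm. 12.11 (b) (p. 290)] -/
theorem isLocallyConstant_betti_restrict_inter_freeLocus :
    IsLocallyConstant fun x : ↥(Module.freeLocus A (K1 ⧸ LinearMap.range f) ∩ Module.freeLocus A (K2 ⧸ LinearMap.range g)) =>
      finrank x.1.asIdeal.ResidueField ((LinearMap.ker (g.baseChange x.1.asIdeal.ResidueField)).map
        (LinearMap.range (f.baseChange x.1.asIdeal.ResidueField)).mkQ) := by
  refine (IsLocallyConstant.iff_exists_open _).2 fun x => ?_
  obtain ⟨U, hU, hxU, hconst⟩ := exists_nhd_betti_eq_of_mem_freeLocus hfg x.1 x.2.2 x.2.1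
  exact ⟨Subtype.val ⁻¹' U, hU.preimage continuous_subtype_val, hxU, fun y hy => hconst y.1 hy⟩

/-! ### §2 Reduced ring: `b` locally constant near `𝔭` ⇒ `𝔭` in the common exchange locus -/

/-- **Conversely, over a REDUCED ring** (Hartshorne III Cor. 12.9 ∕ Mumford §5 Cor. 2 (i) ⇒ (ii), read LOCALLY at `𝔭`; EGA III 7.8.4
(d) ⇒ (a)): if the fibre Betti number is constant on an open neighbourhood of `𝔭` then `𝔭` lies in BOTH exchange loci `freeLocus
(coker f)` and `freeLocus (coker g)`. Shrink to `D(s)`; the Betti function of the base-changed window `K ⊗ A_s` on `Spec A_s` is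
the pull-back of `b` (row 182), hence locally constant; `A_s` is reduced; row 185 over `A_s` makes both cokernels of `K ⊗ A_s`
projective, i.e. `D(s) ⊆` both free loci (row 183). [cite: Hartshorne1977, III Cor. 12.9 (p. 288; held PDF p0350)] [cite:
MumfordAV1970, §5 Cor. 2 (p. 50)] -/
theorem mem_freeLocus_of_betti_eq_nhd [IsReduced A] (p : PrimeSpectrum A) (U : Set (PrimeSpectrum A)) (hU : IsOpen U)
    (hpU : p ∈ U) (hb : ∀ q ∈ U,
      finrank q.asIdeal.ResidueField ((LinearMap.ker (g.baseChange q.asIdeal.ResidueField)).map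
          (LinearMap.range (f.baseChange q.asIdeal.ResidueField)).mkQ) =
        finrank p.asIdeal.ResidueField ((LinearMap.ker (g.baseChange p.asIdeal.ResidueField)).map
          (LinearMap.range (f.baseChange p.asIdeal.ResidueField)).mkQ)) :
    p ∈ Module.freeLocus A (K1 ⧸ LinearMap.range f) ∧ p ∈ Module.freeLocus A (K2 ⧸ LinearMap.range g) := by
  -- shrink `U` to a basic open `D(s) ∋ 𝔭`
  obtain ⟨_, ⟨s, rfl⟩, hps, hsub⟩ := PrimeSpectrum.isTopologicalBasis_basic_opens.exists_subset_of_mem_open hpU hU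
  beta_reduce at hps hsub
  set R := Localization.Away s
  have hmem : ∀ Q : PrimeSpectrum R, PrimeSpectrum.comap (algebraMap A R) Q ∈ U := fun Q =>
    hsub (by rw [← PrimeSpectrum.localization_away_comap_range R s]; exact ⟨Q, rfl⟩)
  -- the Betti function of `K ⊗ A_s` on `Spec A_s` is the pull-back of `b`, hence constant `= b(𝔭)`
  have hbR : IsLocallyConstant fun Q : PrimeSpectrum R => finrank Q.asIdeal.ResidueField
      ((LinearMap.ker ((g.baseChange R).baseChange Q.asIdeal.ResidueField)).map
        (LinearMap.range ((f.baseChange R).baseChange Q.asIdeal.ResidueField)).mkQ) := by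
    refine IsLocallyConstant.of_constant _ fun Q Q' => ?_
    rw [finrank_betti_baseChange_baseChange_eq R Q.asIdeal.ResidueField (f := f) (g := g),
      finrank_betti_baseChange_baseChange_eq R Q'.asIdeal.ResidueField (f := f) (g := g),
      finrank_betti_baseChange_residueField_eq_of_comap_eq R hfg Q (PrimeSpectrum.comap (algebraMap A R) Q) rfl,
      finrank_betti_baseChange_residueField_eq_of_comap_eq R hfg Q' (PrimeSpectrum.comap (algebraMap A R) Q') rfl,
      hb _ (hmem Q), hb _ (hmem Q')]
  -- row 185 over the reduced ring `A_s` for the window `K ⊗ A_s`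
  have hfgR : g.baseChange R ∘ₗ f.baseChange R = 0 := by rw [← LinearMap.baseChange_comp, hfg, LinearMap.baseChange_zero]
  haveI : Module.FinitePresentation R ((R ⊗[A] K1) ⧸ LinearMap.range (f.baseChange R)) :=
    Module.FinitePresentation.of_equiv (tensorQuotRangeEquiv R f)
  obtain ⟨⟨h₁, h₂⟩, -⟩ := exists_bettiBaseChangeEquiv_of_isLocallyConstant_betti_of_finitePresentation hfgR hbR
  haveI : Module.Projective R (R ⊗[A] (K1 ⧸ LinearMap.range f)) := Module.Projective.of_equiv (tensorQuotRangeEquiv R f).symm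
  haveI : Module.Projective R (R ⊗[A] (K2 ⧸ LinearMap.range g)) := Module.Projective.of_equiv (tensorQuotRangeEquiv R g).symm
  -- `D(s)` lies in both free loci (row 183), and `𝔭 ∈ D(s)`
  haveI : Module.FinitePresentation A (K2 ⧸ LinearMap.range g) :=
    haveI := Module.finitePresentation_of_projective A K2
    Module.finitePresentation_of_surjective _ (Submodule.mkQ_surjective _)
      (by rw [Submodule.ker_mkQ]; exact Submodule.fg_range g)
  exact ⟨(basicOpen_subset_freeLocus_iff_projective_tensor (K1 ⧸ LinearMap.range f) s).2 inferInstance hps,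
    (basicOpen_subset_freeLocus_iff_projective_tensor (K2 ⧸ LinearMap.range g) s).2 inferInstance hps⟩

/-- **The jump locus of the fibre Betti number is the complement of the common exchange locus** (EGA III 7.8.4 (a) ⟺ (d),
pointwise; Hartshorne III 12.9 + 12.11; Mumford §5 Cor. 2 (i) ⟺ (ii) read locally), over a REDUCED ring with `K¹` finite, `K²`
finite projective and `coker f` finitely presented: `{𝔭 ; b is constant on a neighbourhood of 𝔭} = freeLocus (coker f) ∩
freeLocus (coker g)` — on which, by rows 183 ∕ 184, `Hⁱ` is locally free of rank `b` and commutes with every base change over the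
`A_s`. [cite: Hartshorne1977, III Cor. 12.9, Thm. 12.11 (pp. 288–290)] [cite: MumfordAV1970, §5 Cor. 2 (p. 50)] [cite:
GortzWedhorn2023, Thm. 23.140 (pp. 482–483)] -/
theorem setOf_exists_nhd_betti_eq_eq_inter_freeLocus [IsReduced A] :
    {p : PrimeSpectrum A | ∃ U : Set (PrimeSpectrum A), IsOpen U ∧ p ∈ U ∧ ∀ q ∈ U,
      finrank q.asIdeal.ResidueField ((LinearMap.ker (g.baseChange q.asIdeal.ResidueField)).map
          (LinearMap.range (f.baseChange q.asIdeal.ResidueField)).mkQ) =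
        finrank p.asIdeal.ResidueField ((LinearMap.ker (g.baseChange p.asIdeal.ResidueField)).map
          (LinearMap.range (f.baseChange p.asIdeal.ResidueField)).mkQ)} =
      Module.freeLocus A (K1 ⧸ LinearMap.range f) ∩ Module.freeLocus A (K2 ⧸ LinearMap.range g) := by
  ext p
  constructor
  · rintro ⟨U, hU, hpU, hb⟩
    exact mem_freeLocus_of_betti_eq_nhd hfg p U hU hpU hb
  · rintro ⟨hp', hp⟩
    exact exists_nhd_betti_eq_of_mem_freeLocus hfg p hp hp'

/-- In particular, over a reduced ring the set where `b` is locally constant is OPEN — it is an intersection of two free loci of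
finitely presented modules (Mathlib `Module.isOpen_freeLocus`). [cite: Hartshorne1977, III Thm. 12.11 (p. 290)] -/
theorem isOpen_setOf_exists_nhd_betti_eq [IsReduced A] :
    IsOpen {p : PrimeSpectrum A | ∃ U : Set (PrimeSpectrum A), IsOpen U ∧ p ∈ U ∧ ∀ q ∈ U,
      finrank q.asIdeal.ResidueField ((LinearMap.ker (g.baseChange q.asIdeal.ResidueField)).map
          (LinearMap.range (f.baseChange q.asIdeal.ResidueField)).mkQ) =
        finrank p.asIdeal.ResidueField ((LinearMap.ker (g.baseChange p.asIdeal.ResidueField)).map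
          (LinearMap.range (f.baseChange p.asIdeal.ResidueField)).mkQ)} := by
  rw [setOf_exists_nhd_betti_eq_eq_inter_freeLocus hfg]
  haveI : Module.FinitePresentation A (K2 ⧸ LinearMap.range g) :=
    haveI := Module.finitePresentation_of_projective A K2
    Module.finitePresentation_of_surjective _ (Submodule.mkQ_surjective _)
      (by rw [Submodule.ker_mkQ]; exact Submodule.fg_range g)
  exact Module.isOpen_freeLocus.inter Module.isOpen_freeLocus

end JumpLocus

end Literature.Algebra.Module
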